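import Summits.QuantumFields.BalabanUV.T4Continuum.Support.NE7K1LinTorusFineWaves

/-!
# NE7K1LinTorusFineWavesFibre — row NE7 (node U5), candidate route HOM, path H1L, cell K1-lin(s): FINE PLANE WAVES OVER THE
# `L`-BLOCKS, part 2 — the modulus of the block mean IS B4 (2.45)'s alias weight `U_L(k; θ)` (fill-in included), and
# COMPLETENESS OVER THE ALIAS FIBRE (NEEDS-ESTIMATE #E1, B-E1 — lens 2's S-69-1 THEOREM I, steps (3b)(3c))

Lineage `b2b-balaban-t4-ne7-p2` (CRUX PROVER NE7 #2), generation 75; file 57 (continuation of file 56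
`NE7K1LinTorusFineWaves`: `fibMom`, `wMean`, `thetaOf`, the one-dimensional sums).  With `θ(p)_μ = 2πp_μ∕P_μ`:

* §1 (3b) the coordinate obstruction **`Sxir_fib_eq_zero`** (`S_ξ(θ_μ + 2πk_μ) = 0 ⇒ p_μ = 0 ∧ k_μ = 0` whenever
  `|p_μ| < P_μ`), the factorisation `wMean_eq_prod`, and **`normSq_wMean`**: `|w_k(p)|² = Ur L k θ(p)` for EVERY dual index
  with `|p_μ| < P_μ` (centred OR raw representative) — `B4Strip.Ur` with its fill-in, met exactly at the zero mode by
  `|mean of 1| = 1`.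
* §2 (3c) **`sum_conj_wMean_mul_fibWave`**: `Σ_k conj(w_k(p))·e_{q_k}(Lβ + j) = χ_p(β)` — the `L^{d+1}` fibre waves weighted by
  the conjugate block means resolve the block-constant extension of the coarse wave (roots of unity:
  `sum_rootUnity`, `dvd_kvec_sub_iff`).

HONEST FRAMING: [folklore] finite Fourier analysis (in-tree variants on the `ZMod` torus:
`King1986.EffectiveLaplacianSymbol.norm_sq_u_pOf`, `King1986.EffectiveLaplacianSymbol.ft_transpose_Qmat`); no estimate;
nothing of Bałaban's asserted; no `sorry`.  Census only (B-E1's identification, Fourier half, part 2; the KKT assembly is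
file 58); NE7 NOT PRINTED ∕ NOT PROVED; spine 0∕9; FIXED FINITE T⁴, rung (B)+1; NOT infinite volume, NOT mass gap, NOT Clay.
HONEST DEPENDENCY: continuum YM on T⁴ ⇐ BetaPertH ∧ nine spine estimates (0/9 proved); BetaPertH ⇐ (D1) ∧ (D4) ∧ CAP+tail;
G-an2-4 gates asym, D1 and NE2/3/4.
-/

noncomputable section

open Finset Matrix Complex

namespace Summit.QuantumFields.BalabanUV.T4Continuum.NE7K1LinTorusFineWavesFibre

open Literature.MathematicalPhysics.QuantumFieldTheory.Balaban1983to89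
open Literature.MathematicalPhysics.QuantumFieldTheory.Balaban1983to89.B4Reflection242
open Literature.MathematicalPhysics.QuantumFieldTheory.Balaban1983to89.B4Lower18
open Literature.MathematicalPhysics.QuantumFieldTheory.Balaban1983to89.B4Green244 (finePt)
open Literature.MathematicalPhysics.QuantumFieldTheory.Balaban1983to89.B4Strip (S1r Sxir uFactorr Ur)
open NE7K1LinTorusLineSymbol NE7K1LinTorusSymbolReal NE7K1LinTorusFineWaves

variable {d : ℕ}

/-! ### §1 (3b): the modulus of the block mean is the alias weight `U_L(k; θ(p))` -/

/-- **THE COORDINATE OBSTRUCTION**: for `|p_μ| < P_μ`, `S_ξ(θ(p)_μ + 2πk_μ) = 0` forces `p_μ = 0` and `k_μ = 0` (so the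
fill-in of `uFactorr` is met exactly at the zero mode). [folklore] -/
theorem Sxir_fib_eq_zero {L : ℕ} (hL : 1 ≤ L) {Pc : Fin (d + 1) → ℕ} (hPc : ∀ i, 1 ≤ Pc i) {p : Fin (d + 1) → ℤ}
    (μ : Fin (d + 1)) (hp : |p μ| < Pc μ) (k : Fin (d + 1) → Fin L)
    (h : Sxir L (thetaOf Pc p μ + 2 * Real.pi * ((k μ : ℕ) : ℝ)) = 0) : p μ = 0 ∧ ((k μ : ℕ)) = 0 := by
  have hL0 : (L : ℝ) ≠ 0 := by exact_mod_cast (show L ≠ 0 by omega)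
  have hPc0 : (0 : ℝ) < Pc μ := by exact_mod_cast hPc μ
  have h2π : (2 * Real.pi : ℝ) ≠ 0 := by positivity
  -- `cos((θ_μ + 2πk_μ)∕L) = 1`
  have hcos : Real.cos ((thetaOf Pc p μ + 2 * Real.pi * ((k μ : ℕ) : ℝ)) / L) = 1 := by
    unfold Sxir at h
    have hL2 : (L : ℝ) ^ 2 ≠ 0 := pow_ne_zero _ hL0
    have h2 := (mul_eq_zero.1 h).resolve_left hL2
    linarith
  obtain ⟨m, hm⟩ := (Real.cos_eq_one_iff _).1 hcos
  have h1 : thetaOf Pc p μ + 2 * Real.pi * ((k μ : ℕ) : ℝ) = (m : ℝ) * (2 * Real.pi) * L := (div_eq_iff hL0).1 hm.symm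
  -- `p_μ = P_μ·(mL − k_μ)`
  have h2 : 2 * Real.pi * ((p μ : ℝ) / Pc μ) = 2 * Real.pi * ((m : ℝ) * L - ((k μ : ℕ) : ℝ)) := by
    unfold thetaOf at h1
    rw [← mul_div_assoc]
    linarith
  have h3 : (p μ : ℝ) / Pc μ = (m : ℝ) * L - ((k μ : ℕ) : ℝ) := (mul_right_inj' h2π).1 h2
  have h4 : (p μ : ℝ) = ((m : ℝ) * L - ((k μ : ℕ) : ℝ)) * Pc μ := (div_eq_iff hPc0.ne').1 h3
  have h5 : p μ = (m * (L : ℤ) - ((k μ : ℕ) : ℤ)) * (Pc μ : ℤ) := by exact_mod_cast h4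
  -- `|mL − k_μ| < 1`
  have hc : m * (L : ℤ) - ((k μ : ℕ) : ℤ) = 0 := by
    have hlt : |m * (L : ℤ) - ((k μ : ℕ) : ℤ)| * (Pc μ : ℤ) < 1 * (Pc μ : ℤ) := by
      rw [one_mul, ← abs_of_nonneg (show (0 : ℤ) ≤ (Pc μ : ℤ) by positivity), ← abs_mul, ← h5]
      rw [abs_of_nonneg (show (0 : ℤ) ≤ (Pc μ : ℤ) by positivity)]
      exact hp
    have hPcZ : (0 : ℤ) < (Pc μ : ℤ) := by exact_mod_cast hPc μ
    exact Int.abs_lt_one_iff.1 (lt_of_mul_lt_mul_right hlt hPcZ.le)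
  have hp0 : p μ = 0 := by rw [h5, hc, zero_mul]
  refine ⟨hp0, ?_⟩
  -- `k_μ = mL` with `0 ≤ k_μ < L` forces `m = 0`
  have hk : ((k μ : ℕ) : ℤ) = m * (L : ℤ) := by linarith
  have hkL : ((k μ : ℕ) : ℤ) < (L : ℤ) := by exact_mod_cast (k μ).2
  rcases le_or_gt m 0 with hm0 | hm1
  · have : m * (L : ℤ) ≤ 0 := Int.mul_nonpos_of_nonpos_of_nonneg hm0 (by positivity)
    omega
  · have : (L : ℤ) ≤ m * (L : ℤ) := le_mul_of_one_le_left (by positivity) hm1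
    omega

section Modulus

variable {L : ℕ} [NeZero L] {Pc : Fin (d + 1) → ℕ}

/-- the fibre wave at an offset is a product of coordinate phases `e^{i·j_μ·(θ_μ + 2πk_μ)∕L}`. [folklore] -/
theorem chiT_fib_kvec_eq_prod (hPc : ∀ i, 1 ≤ Pc i) (p : Fin (d + 1) → ℤ) (k j : Fin (d + 1) → Fin L) :
    chiT (fun i => L * Pc i) (fibMom Pc p k) (kvec j) =
      ∏ μ, Complex.exp (((j μ : ℕ) : ℂ) *
        ((((thetaOf Pc p μ + 2 * Real.pi * ((k μ : ℕ) : ℝ)) / L : ℝ)) : ℂ) * Complex.I) := by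
  rw [chiT_eq_prod]
  refine Finset.prod_congr rfl fun μ _ => ?_
  congr 1
  have hP0 : (Pc μ : ℂ) ≠ 0 := by exact_mod_cast (show Pc μ ≠ 0 by have := hPc μ; omega)
  have hL0 : (L : ℂ) ≠ 0 := by exact_mod_cast NeZero.ne L
  simp only [fibMom, kvec, thetaOf, Pi.add_apply]
  push_cast
  field_simp

/-- the block mean factorises over the coordinates: `w_k(p) = Π_μ L⁻¹Σ_{t<L} e^{it(θ_μ+2πk_μ)∕L}`. [folklore] -/
theorem wMean_eq_prod (hPc : ∀ i, 1 ≤ Pc i) (p : Fin (d + 1) → ℤ) (k : Fin (d + 1) → Fin L) :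
    wMean L Pc p k = ∏ μ, (((L : ℂ))⁻¹ * ∑ t : Fin L, Complex.exp ((t : ℕ) *
      ((((thetaOf Pc p μ + 2 * Real.pi * ((k μ : ℕ) : ℝ)) / L : ℝ)) : ℂ) * Complex.I)) := by
  classical
  unfold wMean
  simp_rw [chiT_fib_kvec_eq_prod hPc p k]
  rw [← Fintype.prod_sum (fun μ (t : Fin L) => Complex.exp (((t : ℕ) : ℂ) *
      ((((thetaOf Pc p μ + 2 * Real.pi * ((k μ : ℕ) : ℝ)) / L : ℝ)) : ℂ) * Complex.I)),
    Finset.prod_mul_distrib, Finset.prod_const, Finset.card_univ, Fintype.card_fin, inv_pow]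

/-- **(3b) THE MODULUS OF THE BLOCK MEAN IS THE ALIAS WEIGHT**: `|w_k(p)|² = Ur L k θ(p)` for every dual index with
`|p_μ| < P_μ` (centred OR raw representative), fill-in included. [folklore] -/
theorem normSq_wMean (hPc : ∀ i, 1 ≤ Pc i) {p : Fin (d + 1) → ℤ} (hp : ∀ μ, |p μ| < Pc μ)
    (k : Fin (d + 1) → Fin L) : Complex.normSq (wMean L Pc p k) = Ur L k (thetaOf Pc p) := by
  have hL : 1 ≤ L := NeZero.one_le
  rw [wMean_eq_prod hPc, map_prod Complex.normSq, Ur]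
  refine Finset.prod_congr rfl fun μ _ => ?_
  refine normSq_mean_exp_eq_uFactorr hL (thetaOf Pc p μ) (k μ : ℕ) fun h => ?_
  obtain ⟨hp0, hk0⟩ := Sxir_fib_eq_zero hL hPc μ (hp μ) k h
  refine ⟨?_, hk0⟩
  simp [thetaOf, hp0]

/-- `‖w_k(p)‖² = Ur L k θ(p)` (norm form). [folklore] -/
theorem norm_sq_wMean (hPc : ∀ i, 1 ≤ Pc i) {p : Fin (d + 1) → ℤ} (hp : ∀ μ, |p μ| < Pc μ)
    (k : Fin (d + 1) → Fin L) : ‖wMean L Pc p k‖ ^ 2 = Ur L k (thetaOf Pc p) := by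
  rw [← Complex.normSq_eq_norm_sq, normSq_wMean hPc hp]

/-- `w_k(p)·conj w_k(p) = Ur L k θ(p)`. [folklore] -/
theorem wMean_mul_conj (hPc : ∀ i, 1 ≤ Pc i) {p : Fin (d + 1) → ℤ} (hp : ∀ μ, |p μ| < Pc μ)
    (k : Fin (d + 1) → Fin L) :
    wMean L Pc p k * starRingEnd ℂ (wMean L Pc p k) = ((Ur L k (thetaOf Pc p) : ℝ) : ℂ) := by
  rw [Complex.mul_conj, normSq_wMean hPc hp]

end Modulus

/-! ### §2 (3c): completeness over the fibre -/

section Completeness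

variable {L : ℕ} [NeZero L] {Pf Pc : Fin (d + 1) → ℕ}

omit [NeZero L] in
/-- offsets differ by a multiple of `L` only when equal. [folklore] -/
theorem dvd_kvec_sub_iff (j t : Fin (d + 1) → Fin L) (μ : Fin (d + 1)) :
    (L : ℤ) ∣ (kvec j - kvec t) μ ↔ j μ = t μ := by
  constructor
  · intro h
    have hlt : |(kvec j - kvec t) μ| < (L : ℤ) := by
      simp only [Pi.sub_apply, kvec]
      have h1 := (j μ).2
      have h2 := (t μ).2
      rw [abs_lt]
      constructor <;> omega
    have h0 := Int.eq_zero_of_abs_lt_dvd h hlt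
    simp only [Pi.sub_apply, kvec] at h0
    exact Fin.ext (by omega)
  · intro h
    simp [kvec, h]

/-- the sum over the fibre of the `(ℤ∕L)^{d+1}`-characters: `Σ_k ω_k(j − t) = L^{d+1}·[j = t]` (offsets). [folklore] -/
theorem sum_chiT_kvec_sub (j t : Fin (d + 1) → Fin L) :
    ∑ k : Fin (d + 1) → Fin L, chiT (fun _ => L) (kvec k) (kvec j - kvec t) =
      if j = t then (L : ℂ) ^ (d + 1) else 0 := by
  classical
  have hL : 1 ≤ L := NeZero.one_le
  have e1 : ∀ k : Fin (d + 1) → Fin L, chiT (fun _ => L) (kvec k) (kvec j - kvec t) =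
      ∏ μ, Complex.exp (((((k μ : ℕ)) * (kvec j - kvec t) μ : ℤ) : ℂ) / (L : ℂ) * (2 * Real.pi * Complex.I)) := by
    intro k
    rw [chiT_eq_prod]
    rfl
  simp_rw [e1]
  rw [← Fintype.prod_sum (fun μ (s : Fin L) =>
      Complex.exp (((((s : ℕ)) * (kvec j - kvec t) μ : ℤ) : ℂ) / (L : ℂ) * (2 * Real.pi * Complex.I)))]
  simp_rw [sum_rootUnity hL, dvd_kvec_sub_iff]
  by_cases hjt : j = t
  · subst hjt
    simp
  · rw [if_neg hjt]
    obtain ⟨μ, hμ⟩ := Function.ne_iff.1 hjt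
    exact Finset.prod_eq_zero (Finset.mem_univ μ) (if_neg hμ)

/-- the conjugate of the block mean. [folklore] -/
theorem conj_wMean (p : Fin (d + 1) → ℤ) (k : Fin (d + 1) → Fin L) :
    starRingEnd ℂ (wMean L Pc p k) =
      (((L : ℂ) ^ (d + 1)))⁻¹ * ∑ t : Fin (d + 1) → Fin L, starRingEnd ℂ (chiT (fun i => L * Pc i) (fibMom Pc p k) (kvec t)) := by
  unfold wMean
  rw [map_mul, map_inv₀, map_pow, map_natCast, map_sum]

/-- **(3c) at the offsets**: `Σ_k conj(w_k(p))·e_{q_k}(j) = 1` for every offset `j ∈ [0,L)^{d+1}`. [folklore] -/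
theorem sum_conj_wMean_mul_kvec (hPc : ∀ i, 1 ≤ Pc i) (p : Fin (d + 1) → ℤ) (j : Fin (d + 1) → Fin L) :
    ∑ k : Fin (d + 1) → Fin L, starRingEnd ℂ (wMean L Pc p k) * chiT (fun i => L * Pc i) (fibMom Pc p k) (kvec j) = 1 := by
  classical
  have hLp : ((L : ℂ) ^ (d + 1)) ≠ 0 := pow_ne_zero _ (by exact_mod_cast NeZero.ne L)
  simp_rw [conj_wMean, mul_assoc, Finset.sum_mul, conj_chiT_mul_chiT]
  rw [← Finset.mul_sum, Finset.sum_comm]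
  simp_rw [chiT_fibMom rfl hPc p _ (kvec j - kvec _)]
  have e : ∀ t : Fin (d + 1) → Fin L,
      ∑ k : Fin (d + 1) → Fin L, chiT (fun i => L * Pc i) p (kvec j - kvec t) * chiT (fun _ => L) (kvec k) (kvec j - kvec t) =
        chiT (fun i => L * Pc i) p (kvec j - kvec t) * (if j = t then (L : ℂ) ^ (d + 1) else 0) := by
    intro t
    rw [← Finset.mul_sum, sum_chiT_kvec_sub]
  simp_rw [e, mul_ite, mul_zero]
  rw [Finset.sum_ite_eq, if_pos (Finset.mem_univ _), sub_self, chiT_zero_right, one_mul, inv_mul_cancel₀ hLp]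

/-- **(3c) COMPLETENESS OVER THE FIBRE**: `Σ_k conj(w_k(p))·e_{q_k}(Lβ + j) = χ_p(β)` at every fine point. [folklore] -/
theorem sum_conj_wMean_mul_fibWave (hPf : Pf = fun i => L * Pc i) (hPc : ∀ i, 1 ≤ Pc i) (p : Fin (d + 1) → ℤ)
    (β : Fin (d + 1) → ℤ) (j : Fin (d + 1) → Fin L) :
    ∑ k : Fin (d + 1) → Fin L, starRingEnd ℂ (wMean L Pc p k) * chiT Pf (fibMom Pc p k) (finePt L β j) =
      chiT Pc p β := by
  subst hPf
  simp_rw [chiT_fib_finePt rfl hPc, mul_left_comm _ (chiT Pc p β)]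
  rw [← Finset.mul_sum, sum_conj_wMean_mul_kvec hPc, mul_one]

/-- (3c) on a chart point of a block-union region: `Σ_k conj(w_k)·e_{q_k}(x) = χ_p(blk_L x)`. [folklore] -/
theorem sum_conj_wMean_mul_fibWave_rchart (hPf : Pf = fun i => L * Pc i) (hPc : ∀ i, 1 ≤ Pc i)
    {T : Finset (Fin (d + 1) → ℤ)} (hTL : IsBlockUnion L T) (p : Fin (d + 1) → ℤ) (β : ↥(T.image (blk L)))
    (j : Fin (d + 1) → Fin L) :
    ∑ k : Fin (d + 1) → Fin L, starRingEnd ℂ (wMean L Pc p k) *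
        chiT Pf (fibMom Pc p k) (rchart NeZero.one_le hTL β j).1 = chiT Pc p β.1 :=
  sum_conj_wMean_mul_fibWave hPf hPc p β.1 j

end Completeness

end Summit.QuantumFields.BalabanUV.T4Continuum.NE7K1LinTorusFineWavesFibre

end
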